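import Literature.NumberTheory.GaloisRepresentations.LubinTateColemanCoordPadicPowersTwo
import Literature.NumberTheory.GaloisRepresentations.LubinTateColemanUnitsImageGaloisTwo
import Literature.NumberTheory.GaloisRepresentations.LubinTateColemanUnitsImageTraceTwo
import HarnessLib

/-!
# The Galois action on the two-variable Coleman image READ IN `Λ = 𝒪_F⟦X⟧⟦T⟧`: the Amice element of `σ̃` is the binomial series
# `(1+X)^c` (`σ̃|_{E_∞} = φ^c · (ℤ/d-part)`, `c ∈ ℤ_p`), and for `χ_π(σ̃) = γ^{c'} ∈ U_2` the operator `𝒯_{σ̃}` is the SCALAR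
# `(1+T)^{c'}·(1+X)^{c}` composed with the `ℤ/d`-shift — the local half of the frame dictionary `γ̃ᵢ ↦ (1+X)^{aᵢ}(1+T)^{cᵢ}`

De Shalit, *Iwasawa theory of elliptic curves with complex multiplication* (1987), Ch. I §3.1 (`ℤ_p⟦𝒢⟧ = Λ[Δ]`, `u^α ↦ (1+S)^α`), §3.4
Lemma (ii), §3.7–3.8 (the Coleman map `i` is `ℤ_p⟦𝒢⟧`-linear), III §1.3.  The tree: for every `σ̃ ∈ Γ_F` the two-variable Coleman image
satisfies `Col(σ̃·β) = galOpₗ (χ_π σ̃) g s (Col β)` with `galOpₗ v g s = σ_v ∘ (C g •) ∘ shift_s` (`LubinTateColemanUnitsImageGaloisTwo.colemanImage_galAct`)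
for an AMICE PAIR `(g, s) ∈ 𝒪_F⟦X⟧ × ℤ/d` of `σ̃|_{E_∞}`, pinned LEVELWISE by `ω_m ∣ g − (1+X)^{a_m}` where `σ̃|_{E_m} = σ₀^{a_m}`
(`exists_amicePair_galois`).  With the `p`-adic power dictionaries of this seat (`PowerSeriesTopNilpotentPadicPowers` §4,
`LubinTateColemanCoordPadicPowersTwo`) THIS file reads both components as binomial series (everything PROVED, 0 sorry, no definitions):

* §1 ★★ **`exists_amicePair_binomialSeries`** — for `𝒪_F` a `ℤ_p`-algebra, every `σ̃ ∈ Γ_F` has an Amice pair of the form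
  **`((1+X)^c, s)`, `c ∈ ℤ_p`**, with `c ≡ a_m (mod p^m)` for the Frobenius exponents `a_m` of `σ̃` on `E_m` (the exponents are compatible
  modulo `[E_m : F] = d·p^m`; `PowerSeriesTopNilpotentPadicPowers.exists_eq_binomialSeries_of_forall_dvd`); ★★ `exists_colemanImage_galAct_binomialSeries`
  (**`Col(σ̃·β) = galOpₗ (χ_π σ̃) ((1+X)^c) s (Col β)`**).
* §2 (`p = 2`, `χ_π(σ̃) =: v ∈ U_2` with a `2`-adic logarithm `c'` to base `γ`) ★★ `galOpₗ_eq_smul_indexShiftₗ` —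
  **`galOpₗ v g s G = ((1+T)^{c'} · C g) • shift_s G`**; ★★★ **`indexTraceₗ_galOpₗ_eq_smul`** — on the `ℤ/d`-trace `Σ` the shift disappears:
  **`Σ(𝒯_{v,g,s} G) = ((1+T)^{c'}·C g) • Σ G`**; and with §1, ★★★ `exists_indexTraceₗ_colemanImage_galAct_eq_smul`: for `σ̃` with `χ_π(σ̃) ∈ U_2`
  there are `c' c ∈ ℤ₂` with **`Σ Col(σ̃·β) = ((1+T)^{c'}·(1+X)^{c}) • Σ Col(β)`** — a Galois element of the two-variable local tower acts on the
  trace module `N_Σ ⊆ M₁` as the FRAME MONOMIAL `(1+X)^{c}(1+T)^{c'} ∈ 𝒪_F⟦X⟧⟦T⟧` (`IwasawaAlgebraTwoVarGeneratorChange.frameSubst_one_add_X`'s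
  shape), which is what identifies the pull-back of the local `Λ`-structure along the global generators `γ̃ᵢ` with a frame substitution.

Units `v ∉ U_2` (`v = −v₀`, `v₀ ∈ U_2`) are reduced to these by `σ_v = σ_{−1} ∘ σ_{v₀}` (`unitTwistₗ_mul`) and, on the `ε`-coinvariants, by
`LubinTateColemanCoordPadicPowersTwo.colemanDeltaCoinvFun_unitTwistₗ_neg_one_eq` (`t_{−v₀}^ε = ε·(1+T)^{c'}`).

## References
* E. de Shalit, *Iwasawa theory of elliptic curves with complex multiplication* (1987), Ch. I §3.1, §3.4 Lemma (ii), §3.7, §3.8 (17); Ch. III §1.3. [deShalit1987]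
* L. C. Washington, *Introduction to Cyclotomic Fields*, 2nd ed. (1997), §7.1, §13.2. [Washington1997]
-/

noncomputable section

open scoped PowerSeries.WithPiTopology

namespace Literature.NumberTheory.GaloisRepresentations

section UnitsImageGaloisPadicTwo

open GaloisRepresentations.IsNonarchimedeanLocalField LubinTate ValuativeRel Field Finset

variable {F : Type} [Field F] [ValuativeRel F] [TopologicalSpace F] [IsNonarchimedeanLocalField F]

attribute [local instance] ltNormUniformSpace ltNormIsUniformAddGroup rk1 nF nE fintypeResidueField

variable {p : ℕ} [hp : Fact p.Prime] {d : ℕ} (hd : d.Coprime p)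
variable {π : 𝒪[F]} (hπ : (valuation F).IsUniformizer (π : F))
variable (E : ℕ → IntermediateField F (AlgebraicClosure F)) [∀ m, FiniteDimensional F (E m)] [∀ m, Normal F (E m)]
  [∀ m, IsGalois F (E m)] (hmono : Monotone E) (hE : ∀ m, E m ≤ maxUnramified F) (hdeg : ∀ m, Module.finrank F (E m) = d * p ^ m)
  {σ₀ : absoluteGaloisGroup F} (hσ₀ : IsAbsArithFrob σ₀) (hq : residueFieldCard F = 2)
variable (u : (LTCoeff F)ˣ) (hu : LTCoeff.of F π = residueFieldCard F * u) (γ : 𝒪[F]ˣ)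

/-! ### §1. The Amice element of `σ̃` is `(1+X)^c` -/

section Amice

variable [NeZero d] [IsAdicComplete (Ideal.span {(p : 𝒪[F])}) 𝒪[F]] [Algebra ℤ_[p] 𝒪[F]]

omit [NeZero d] in
include hmono hE hdeg hσ₀ in
/-- ★★ **The Amice pair of `σ̃|_{E_∞}` is `((1+X)^c, s)` with `c ∈ ℤ_p` the `p`-adic Frobenius exponent of `σ̃`**: for every `m`, with
`σ̃|_{E_m} = σ₀^{a_m}`, `ω_m ∣ (1+X)^c − (1+X)^{a_m}`, `a_m ≡ s (mod d)` and `c ≡ a_m (mod p^m)` (the exponents `a_m` are compatible modulo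
`[E_m : F] = d p^m`, so they converge in `ℤ/d × ℤ_p`; the `ℤ_p`-component is read through `PadicInt.lift` and the series through the separation
`⋂ (ω_m) = 0`). [cite: deShalit1987, Ch. I §3.1] [cite: Washington1997, §7.1, §13.2] -/
theorem exists_amicePair_binomialSeries (σ : absoluteGaloisGroup F) :
    ∃ (c : ℤ_[p]) (s : ZMod d), ∀ m, ∃ a : ℕ, (∀ x : E m, σ • (x : AlgebraicClosure F) = (σ₀ ^ a) • (x : AlgebraicClosure F)) ∧
      ((1 + PowerSeries.X : PowerSeries 𝒪[F]) ^ p ^ m - 1) ∣ PowerSeries.binomialSeries 𝒪[F] c - (1 + PowerSeries.X) ^ a ∧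
        (a : ZMod d) = s ∧ PadicInt.toZModPow m c = (a : ZMod (p ^ m)) := by
  obtain ⟨g, s, hg⟩ := exists_amicePair_galois p d E hmono hE hdeg hσ₀ σ
  choose a ha hga hsa using hg
  have hcompat : ∀ m₁ m₂ : ℕ, m₁ ≤ m₂ → a m₂ ≡ a m₁ [MOD p ^ m₁] := by
    intro m₁ m₂ hm
    have h : ∀ x : E m₁, (σ₀ ^ a m₂) • (x : AlgebraicClosure F) = (σ₀ ^ a m₁) • (x : AlgebraicClosure F) := fun x => by
      have h2 : σ • ((x : E m₁) : AlgebraicClosure F) = (σ₀ ^ a m₂) • ((x : E m₁) : AlgebraicClosure F) :=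
        ha m₂ ⟨(x : AlgebraicClosure F), hmono hm x.2⟩
      exact h2.symm.trans (ha m₁ x)
    have hmod := modEq_of_forall_smul_eq (E m₁) (hE m₁) hσ₀ h
    rw [hdeg m₁] at hmod
    exact hmod.of_mul_left d
  obtain ⟨c, hc, hgc⟩ := exists_eq_binomialSeries_of_forall_dvd (ϖ := (p : 𝒪[F])) (Ideal.mem_span_singleton_self _) hcompat hga
  exact ⟨c, s, fun m => ⟨a m, ha m, hgc ▸ hga m, hsa m, hc m⟩⟩

variable {θ : ∀ m, unitBall (E m)} (hθ : ∀ m, IsIntegralNormalGen (E m) (θ m))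
  (hcoh : ∀ m, unitBallTrace (hmono (Nat.le_succ m)) (θ (m + 1)) = θ m)

include hdeg in
/-- ★★ **`Col(σ̃·β) = galOpₗ (χ_π σ̃) ((1+X)^c) s (Col β)`** for every `σ̃ ∈ Γ_F` and every norm-coherent `β`, with `c ∈ ℤ_p` the Frobenius
exponent of `σ̃` (`c ≡ a_m (mod p^m)`, `σ̃|_{E_m} = σ₀^{a_m}`) and `s ∈ ℤ/d` its `ℤ/d`-component. [cite: deShalit1987, Ch. I §3.1, §3.8 (17)] -/
theorem exists_colemanImage_galAct_binomialSeries [IsAdicComplete (Ideal.span {intBase F (LTCoeff.of F π)}) (PowerSeries 𝒪[F])]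
    (σ : absoluteGaloisGroup F) :
    ∃ (c : ℤ_[p]) (s : ZMod d),
      (∀ m, ∃ a : ℕ, (∀ x : E m, σ • (x : AlgebraicClosure F) = (σ₀ ^ a) • (x : AlgebraicClosure F)) ∧ (a : ZMod d) = s ∧
        PadicInt.toZModPow m c = (a : ZMod (p ^ m))) ∧
      ∀ {β : ∀ m, RelNormCoherentUnits hπ (E m)} (hβ : ∀ m, (β (m + 1)).baseNorm hπ (hmono (Nat.le_succ m)) = β m),
        colemanImage hd hπ E hmono hE hdeg hσ₀ hq u hu γ hθ hcoh (β := fun m => (β m).galAct σ) (galAct_baseNormCoherent hπ E hmono σ hβ) =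
          galOpₗ hπ hq u hu γ (lubinTateChar hπ σ) (PowerSeries.binomialSeries 𝒪[F] c) s
            (colemanImage hd hπ E hmono hE hdeg hσ₀ hq u hu γ hθ hcoh hβ) := by
  obtain ⟨c, s, hcs⟩ := exists_amicePair_binomialSeries E hmono hE hdeg hσ₀ σ
  refine ⟨c, s, fun m => ?_, fun hβ => colemanImage_galAct hd hπ E hmono hE hdeg hσ₀ hq u hu γ hθ hcoh hβ σ fun m => ?_⟩
  · obtain ⟨a, ha, -, hsa, hca⟩ := hcs m
    exact ⟨a, ha, hsa, hca⟩
  · obtain ⟨a, ha, hga, hsa, -⟩ := hcs m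
    exact ⟨a, ha, hga, hsa⟩

end Amice

/-! ### §2. At `p = 2`: `𝒯_{σ̃}` is the scalar `(1+T)^{c'}(1+X)^{c}` (composed with the `ℤ/d`-shift, which the trace `Σ` forgets) -/

section Scalar

variable [IsAdicComplete (Ideal.span {intBase F (LTCoeff.of F π)}) (PowerSeries 𝒪[F])] [NeZero d]
variable {w : 𝒪[F]ˣ} (hγ : (γ : 𝒪[F]) = 1 + π ^ 2 * w)

omit hp [NeZero d] in
include hγ in
/-- ★★ **`galOpₗ v g s G = ((1+T)^{c'} · C g) • shift_s G`** for `v = γ^{c'} ∈ U_2` (`c' ∈ ℤ₂` a `2`-adic logarithm of `v` to base `γ`; `𝒪_F` a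
`ℤ₂`-algebra): the Lubin–Tate twist is the scalar `(1+T)^{c'}` (`LubinTateColemanCoordPadicPowersTwo.unitTwistₗ_eq_binomialSeries_smul`), the
Amice element the scalar `C g`. [cite: deShalit1987, Ch. I §3.1, §3.4 Lemma (ii)] -/
theorem galOpₗ_eq_smul_indexShiftₗ [Algebra ℤ_[2] 𝒪[F]] {v : 𝒪[F]ˣ} {c' : ℤ_[2]}
    (hc' : ∀ n : ℕ, ∃ j : ℕ, PadicInt.toZModPow n c' = (j : ZMod (2 ^ n)) ∧ π ^ (n + 2) ∣ (v : 𝒪[F]) - (γ : 𝒪[F]) ^ j)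
    (g : PowerSeries 𝒪[F]) (s : ZMod d) (G : ZMod d → ColemanCoordModule hπ hq (intBase F) u hu γ) :
    galOpₗ hπ hq u hu γ v g s G =
      (PowerSeries.binomialSeries (PowerSeries 𝒪[F]) c' * PowerSeries.C g : PowerSeries (PowerSeries 𝒪[F])) • indexShiftₗ hπ hq u hu γ s G := by
  funext j
  rw [galOpₗ_apply, unitTwistₗ_eq_binomialSeries_smul hπ hq (intBase F) u hu γ hγ hc', Pi.smul_apply, indexShiftₗ_apply, mul_smul]

omit hp in
include hγ in
/-- ★★★ **`Σ (𝒯_{v,g,s} G) = ((1+T)^{c'} · C g) • Σ G`** for `v = γ^{c'} ∈ U_2`: on the `ℤ/d`-trace a Galois operator of the two-variable local tower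
is a SCALAR of `Λ = 𝒪_F⟦X⟧⟦T⟧`. [cite: deShalit1987, Ch. I §3.1, §3.7 (13)] -/
theorem indexTraceₗ_galOpₗ_eq_smul [Algebra ℤ_[2] 𝒪[F]] {v : 𝒪[F]ˣ} {c' : ℤ_[2]}
    (hc' : ∀ n : ℕ, ∃ j : ℕ, PadicInt.toZModPow n c' = (j : ZMod (2 ^ n)) ∧ π ^ (n + 2) ∣ (v : 𝒪[F]) - (γ : 𝒪[F]) ^ j)
    (g : PowerSeries 𝒪[F]) (s : ZMod d) (G : ZMod d → ColemanCoordModule hπ hq (intBase F) u hu γ) :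
    indexTraceₗ hπ hq u hu γ (galOpₗ hπ hq u hu γ v g s G) =
      (PowerSeries.binomialSeries (PowerSeries 𝒪[F]) c' * PowerSeries.C g : PowerSeries (PowerSeries 𝒪[F])) • indexTraceₗ hπ hq u hu γ G := by
  rw [indexTraceₗ_galOpₗ, unitTwistₗ_eq_binomialSeries_smul hπ hq (intBase F) u hu γ hγ hc', mul_smul]

variable [IsAdicComplete (Ideal.span {(p : 𝒪[F])}) 𝒪[F]]
variable {θ : ∀ m, unitBall (E m)} (hθ : ∀ m, IsIntegralNormalGen (E m) (θ m))
  (hcoh : ∀ m, unitBallTrace (hmono (Nat.le_succ m)) (θ (m + 1)) = θ m)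

include hdeg hγ in
/-- ★★★ **A Galois element acts on the trace of the two-variable Coleman image as a FRAME MONOMIAL**: at `p = 2`, for `σ̃ ∈ Γ_F` with
`χ_π(σ̃) ∈ U_2` there are `c', c ∈ ℤ₂` (`χ_π(σ̃) = γ^{c'}`, `σ̃|_{E_∞} = σ₀^{c}·(ℤ/d-part)`) with
**`Σ Col(σ̃·β) = ((1+T)^{c'} · (1+X)^{c}) • Σ Col(β)`** for every norm-coherent `β` (`(1+X)^c` entering as the constant `C ((1+X)^c)` of `Λ = 𝒪_F⟦X⟧⟦T⟧`).
[cite: deShalit1987, Ch. I §3.1, §3.7 (13), §3.8 (17); Ch. III §1.3] -/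
theorem exists_indexTraceₗ_colemanImage_galAct_eq_smul (hp2 : p = 2) [Algebra ℤ_[p] 𝒪[F]] (σ : absoluteGaloisGroup F)
    (hσ : π ^ 2 ∣ (lubinTateChar hπ σ : 𝒪[F]) - 1) :
    ∃ c' c : ℤ_[p],
      (∀ n : ℕ, ∃ j : ℕ, PadicInt.toZModPow n c' = (j : ZMod (p ^ n)) ∧ π ^ (n + 2) ∣ (lubinTateChar hπ σ : 𝒪[F]) - (γ : 𝒪[F]) ^ j) ∧
      (∀ m, ∃ a : ℕ, (∀ x : E m, σ • (x : AlgebraicClosure F) = (σ₀ ^ a) • (x : AlgebraicClosure F)) ∧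
        PadicInt.toZModPow m c = (a : ZMod (p ^ m))) ∧
      ∀ {β : ∀ m, RelNormCoherentUnits hπ (E m)} (hβ : ∀ m, (β (m + 1)).baseNorm hπ (hmono (Nat.le_succ m)) = β m),
        indexTraceₗ hπ hq u hu γ (colemanImage hd hπ E hmono hE hdeg hσ₀ hq u hu γ hθ hcoh (β := fun m => (β m).galAct σ)
            (galAct_baseNormCoherent hπ E hmono σ hβ)) =
          (PowerSeries.binomialSeries (PowerSeries 𝒪[F]) c' * PowerSeries.C (PowerSeries.binomialSeries 𝒪[F] c) :
              PowerSeries (PowerSeries 𝒪[F])) •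
            indexTraceₗ hπ hq u hu γ (colemanImage hd hπ E hmono hE hdeg hσ₀ hq u hu γ hθ hcoh hβ) := by
  subst hp2
  obtain ⟨c', hc'⟩ := exists_padicInt_gen_pow_congr hπ hq
    (t := Units.map (LTCoeff.of F).symm.toRingHom.toMonoidHom u⁻¹) (by
      have h := congrArg (LTCoeff.of F).symm (two_eq_of_mul_inv (π := π) hq u hu)
      rw [map_ofNat, map_mul, RingEquiv.symm_apply_apply] at h
      exact h) hγ hσ
  obtain ⟨c, s, hcs, hcol⟩ := exists_colemanImage_galAct_binomialSeries hd hπ E hmono hE hdeg hσ₀ hq u hu γ hθ hcoh σ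
  refine ⟨c', c, hc', fun m => ?_, fun hβ => ?_⟩
  · obtain ⟨a, ha, -, hca⟩ := hcs m
    exact ⟨a, ha, hca⟩
  · rw [hcol hβ, indexTraceₗ_galOpₗ_eq_smul hπ hq u hu γ hγ hc']

end Scalar

end UnitsImageGaloisPadicTwo

end Literature.NumberTheory.GaloisRepresentations

end
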